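import Mathlib
import Literature.Probability.Percolation.PercolationProofs
import Literature.Probability.LatticeModels.ONModelSpecification
import HarnessLib

/-!
# Crux `PercBurnResprinkle.JumpFireBreak` (stmt-CriticalPhenomena-7204), line `vacant-coins-fresh-spine` — stub `stub_boxMarkov`

Helper file for the crux skeleton `Cruxes/JumpFireBreak/Lines/vacant-coins-fresh-spine.lean` (lead
prover-line-stmt-CriticalPhenomena-7204-0).  Proves exactly the registered stub signature; lands with
`--supports stmt-CriticalPhenomena-7204`.

Finite-volume spatial Markov identity of the box-burnt set (stopping-set decoupling), levels `(p, q)`, box `N`.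

## The argument

Write `μ = labelMeasure V` (i.i.d. uniform labels `U e`, `e : Sym2 V`, an infinite product measure),
`B(U) = {v | ∃ w ∉ D, v ↔ w at level p}` for the set of vertices joined to the outside of the finite box
`D` (the "burnt" set; every vertex outside `D` is burnt, so `B(U) = Tᶜ` for some `T ⊆ D`: finitely many
values), and `vac(U, W) = {e ∈ η_q(W) | e ∩ B(U) = ∅}` for the level-`q` vacant configuration off the
burnt set read from a second label field `W`.

* (`burnt_eq_compl_transfer`) On `{B = Tᶜ}` the burnt set is decided by the labels of the pairs NOT
  inside `T`: every open path from `Tᶜ` to `Dᶜ` stays in `Tᶜ`, and a vertex of `T` joined to `Dᶜ` would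
  cross a boundary edge of `T`, which is an edge not inside `T`.  Hence `{B = Tᶜ}` is measurable for the
  cylinder σ-algebra of `{e | e ⊄ T}` (`Measurable.measurable_cylinderEvents_of_dependsOn`).
* On `{B = Tᶜ}`, `vac(U, W) = {e ∈ η_q(W) | e ⊆ T}`, a function of the labels of the pairs inside `T`,
  measurable for the cylinder σ-algebra of `{e | e ⊆ T}`.
* Disjoint sets of coordinates of a product measure generate independent σ-algebras
  (`iIndepFun_infinitePi`, `indep_iSup_of_disjoint`).
* (`prod_apply_eq_of_decomp`) Abstract decoupling: summing over the finitely many values `Tᶜ`,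
  both `(μ ⊗ μ){(B(U), vac(U, U)) ∈ S}` and `(μ ⊗ μ){(B(U), vac(U, U')) ∈ S}` equal
  `Σ_T μ{B = Tᶜ} · μ{W | (Tᶜ, {e ∈ η_q(W) | e ⊆ T}) ∈ S}` (independence on the left,
  `Measure.prod_prod` on the right).

No new definitions: the burnt set and the vacant configurations are written out as set-builder
expressions exactly as in the registered statement.
-/

noncomputable section

namespace Summit.CriticalPhenomena.PercolationContinuityZ3.Theorems

open MeasureTheory ProbabilityTheory Literature.Probability.Percolation Literature.Probability.LatticeModels

/-! ### Abstract decoupling along a finitely-valued stopping variable -/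

/-- **Abstract stopping-set decoupling.** Let `μ` be a probability measure, `B : Ω → X` a variable
taking on `Ω` only the finitely many distinct values `t i`, `i ∈ s`, and suppose that for each `i` the
event `{B = t i}` is measurable for a σ-algebra `m₁ i`, the map `G i` is measurable for a σ-algebra
`m₂ i` independent of `m₁ i`, and the two-argument map `F` satisfies `F U W = G i W` whenever
`B U = t i`.  Then under `μ ⊗ μ` the pairs `(B U, F U U)` and `(B U, F U U')` have the same law on
measurable sets: both probabilities equal `Σ_{i ∈ s} μ{B = t i} · μ{W | (t i, G i W) ∈ S}`. -/
private theorem prod_apply_eq_of_decomp {Ω X Y ι : Type*} [mΩ : MeasurableSpace Ω]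
    [MeasurableSpace X] [MeasurableSpace Y] (μ : Measure Ω) [IsProbabilityMeasure μ]
    (s : Finset ι) (B : Ω → X) (t : ι → X) (F : Ω → Ω → Y) (G : ι → Ω → Y)
    (m₁ m₂ : ι → MeasurableSpace Ω) (hm₁ : ∀ i, m₁ i ≤ mΩ) (hm₂ : ∀ i, m₂ i ≤ mΩ)
    (hind : ∀ i, Indep (m₁ i) (m₂ i) μ)
    (hcover : ∀ U, ∃ i ∈ s, B U = t i) (htinj : Set.InjOn t ↑s)
    (hF : ∀ i U W, B U = t i → F U W = G i W)
    (hB : ∀ i ∈ s, MeasurableSet[m₁ i] {U | B U = t i}) (hG : ∀ i, Measurable[m₂ i] (G i))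
    {S : Set (X × Y)} (hS : MeasurableSet S) :
    μ.prod μ {π : Ω × Ω | (B π.1, F π.1 π.1) ∈ S} =
      μ.prod μ {π : Ω × Ω | (B π.1, F π.1 π.2) ∈ S} := by
  have hE : ∀ i ∈ s, MeasurableSet {U | B U = t i} := fun i hi => hm₁ i _ (hB i hi)
  have hR' : ∀ i, MeasurableSet[m₂ i] (G i ⁻¹' (Prod.mk (t i) ⁻¹' S)) := fun i =>
    hG i (measurable_prodMk_left hS)
  have hR : ∀ i, MeasurableSet (G i ⁻¹' (Prod.mk (t i) ⁻¹' S)) := fun i => hm₂ i _ (hR' i)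
  have hdisj : ∀ i ∈ s, ∀ j ∈ s, i ≠ j → ∀ U, B U = t i → B U = t j → False :=
    fun i hi j hj hij U hUi hUj => hij (htinj hi hj (hUi.symm.trans hUj))
  -- the two events, decomposed along the value of `B`
  have hL : {π : Ω × Ω | (B π.1, F π.1 π.1) ∈ S} =
      ⋃ i ∈ s, ({U | B U = t i} ∩ G i ⁻¹' (Prod.mk (t i) ⁻¹' S)) ×ˢ (Set.univ : Set Ω) := by
    ext π
    simp only [Set.mem_setOf_eq, Set.mem_iUnion, Set.mem_prod, Set.mem_univ, and_true,
      Set.mem_inter_iff, Set.mem_preimage, exists_prop]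
    constructor
    · intro h
      obtain ⟨i, hi, hBi⟩ := hcover π.1
      refine ⟨i, hi, hBi, ?_⟩
      rwa [hBi, hF i π.1 π.1 hBi] at h
    · rintro ⟨i, -, hBi, h⟩
      rwa [hBi, hF i π.1 π.1 hBi]
  have hRt : {π : Ω × Ω | (B π.1, F π.1 π.2) ∈ S} =
      ⋃ i ∈ s, {U | B U = t i} ×ˢ (G i ⁻¹' (Prod.mk (t i) ⁻¹' S)) := by
    ext π
    simp only [Set.mem_setOf_eq, Set.mem_iUnion, Set.mem_prod, Set.mem_preimage, exists_prop]
    constructor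
    · intro h
      obtain ⟨i, hi, hBi⟩ := hcover π.1
      refine ⟨i, hi, hBi, ?_⟩
      rwa [hBi, hF i π.1 π.2 hBi] at h
    · rintro ⟨i, -, hBi, h⟩
      rwa [hBi, hF i π.1 π.2 hBi]
  have hdL : Set.PairwiseDisjoint (↑s : Set ι)
      (fun i => ({U | B U = t i} ∩ G i ⁻¹' (Prod.mk (t i) ⁻¹' S)) ×ˢ (Set.univ : Set Ω)) := by
    intro i hi j hj hij
    refine Set.disjoint_left.2 fun π hπi hπj => ?_
    exact hdisj i hi j hj hij π.1 (Set.mem_prod.1 hπi).1.1 (Set.mem_prod.1 hπj).1.1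
  have hdR : Set.PairwiseDisjoint (↑s : Set ι)
      (fun i => {U | B U = t i} ×ˢ (G i ⁻¹' (Prod.mk (t i) ⁻¹' S))) := by
    intro i hi j hj hij
    refine Set.disjoint_left.2 fun π hπi hπj => ?_
    exact hdisj i hi j hj hij π.1 (Set.mem_prod.1 hπi).1 (Set.mem_prod.1 hπj).1
  rw [hL, hRt, measure_biUnion_finset hdL fun i hi => ((hE i hi).inter (hR i)).prod MeasurableSet.univ,
    measure_biUnion_finset hdR fun i hi => (hE i hi).prod (hR i)]
  refine Finset.sum_congr rfl fun i hi => ?_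
  rw [Measure.prod_prod, Measure.prod_prod, measure_univ, mul_one]
  exact (Indep_iff (m₁ i) (m₂ i) μ).1 (hind i) _ _ (hB i hi) (hR' i)

/-- A measurable event of the product space `ι → ℝ` whose occurrence depends only on the coordinates
in `Δ` is measurable for the cylinder σ-algebra `cylinderEvents Δ` generated by those coordinates
(set version of the tree's `Measurable.measurable_cylinderEvents_of_dependsOn`). -/
private theorem measurableSet_cyl_of_dependsOn {ι : Type*} {A : Set (ι → ℝ)} (hA : MeasurableSet A)
    {Δ : Set ι} (hdep : DependsOn (fun U : ι → ℝ => U ∈ A) Δ) :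
    MeasurableSet[cylinderEvents (X := fun _ : ι => ℝ) Δ] A := by
  have h1 : Measurable fun U : ι → ℝ => U ∈ A := (measurableSet_setOf (p := fun U => U ∈ A)).1 hA
  have h2 : Measurable[cylinderEvents (X := fun _ : ι => ℝ) Δ] fun U : ι → ℝ => U ∈ A :=
    h1.measurable_cylinderEvents_of_dependsOn hdep
  have h3 : MeasurableSet[cylinderEvents (X := fun _ : ι => ℝ) Δ]
      ((fun U : ι → ℝ => U ∈ A) ⁻¹' {True}) :=
    h2 (measurableSet_singleton True)
  have h4 : (fun U : ι → ℝ => U ∈ A) ⁻¹' {True} = A := by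
    ext U
    simp
  rwa [h4] at h3

/-! ### The burnt set: stability under changing the labels of the pairs inside `T` -/

/-- Transfer of an open path: if every vertex joined to `w` in `H` lies outside `T`, and every edge of
`H` with an endpoint outside `T` is also an edge of `H'`, then an `H`-walk to `w` gives an `H'`-path
to `w` (induction along the walk: each of its vertices is joined to `w`, hence outside `T`). -/
private theorem reachable_transfer {V : Type*} {H H' : SimpleGraph V} {T : Set V}
    (hedge : ∀ x y : V, x ∉ T → H.Adj x y → H'.Adj x y) {v w : V} (walk : H.Walk v w) :
    (∀ u : V, H.Reachable u w → u ∉ T) → H'.Reachable v w := by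
  induction walk with
  | nil => exact fun _ => SimpleGraph.Reachable.refl _
  | cons hab walk' ih =>
    exact fun hT =>
      (hedge _ _ (hT _ ⟨SimpleGraph.Walk.cons hab walk'⟩) hab).reachable.trans (ih hT)

/-- **Graph form of the stopping-set property.** Let `T ⊆ D` and let `H`, `H'` be two graphs with
the same edges at every vertex outside `T`.  If the set of vertices joined in `H` to the outside of
`D` is exactly `Tᶜ`, then the same holds for `H'`: `Tᶜ` is still joined to `Dᶜ` (paths from `Tᶜ`
stay in `Tᶜ`, where the two graphs agree), and no vertex of `T` is joined to `Dᶜ` in `H'` (such a path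
would leave `T` through an edge `{x, y}`, `x ∈ T`, `y ∉ T`, common to both graphs, making `x`
joined to `Dᶜ` in `H`). -/
private theorem burnt_eq_compl_transfer {V : Type*} {H H' : SimpleGraph V} {D T : Set V}
    (hTD : T ⊆ D) (hedge : ∀ x y : V, x ∉ T → (H.Adj x y ↔ H'.Adj x y))
    (h : {v : V | ∃ w : V, w ∉ D ∧ H.Reachable v w} = Tᶜ) :
    {v : V | ∃ w : V, w ∉ D ∧ H'.Reachable v w} = Tᶜ := by
  have hmem : ∀ v : V, (∃ w : V, w ∉ D ∧ H.Reachable v w) ↔ v ∉ T := fun v => by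
    simpa only [Set.mem_setOf_eq, Set.mem_compl_iff] using Set.ext_iff.1 h v
  ext v
  rw [Set.mem_setOf_eq, Set.mem_compl_iff]
  constructor
  · rintro ⟨w, hwD, ⟨walk⟩⟩ hvT
    obtain ⟨d, -, hd1, hd2⟩ := walk.exists_boundary_dart T hvT fun hw => hwD (hTD hw)
    have hadj : H.Adj d.snd d.fst := (hedge _ _ hd2).2 d.adj.symm
    obtain ⟨w', hw'D, hw'⟩ := (hmem _).2 hd2
    exact (hmem _).1 ⟨w', hw'D, hadj.symm.reachable.trans hw'⟩ hd1
  · intro hvT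
    obtain ⟨w, hwD, ⟨walk⟩⟩ := (hmem v).2 hvT
    exact ⟨w, hwD, reachable_transfer (fun x y hx hxy => (hedge x y hx).1 hxy) walk
      fun u hu => (hmem u).1 ⟨w, hwD, hu⟩⟩

/-- Two label fields that agree on every pair not inside `T` induce level-`p` open graphs with the
same edges at every vertex outside `T` (an edge `{x, y}` with `x ∉ T` is a pair not inside `T`). -/
private theorem openGraph_adj_iff_of_agree {V : Type*} (G : SimpleGraph V) (p : ℝ) {T : Set V}
    {U U' : Sym2 V → ℝ} (hagree : ∀ e : Sym2 V, ¬ (∀ y ∈ e, y ∈ T) → U e = U' e)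
    (x y : V) (hx : x ∉ T) :
    (openGraph (configOfLabels p U G)).Adj x y ↔ (openGraph (configOfLabels p U' G)).Adj x y := by
  have hxy : U s(x, y) = U' s(x, y) := hagree _ fun hin => hx (hin x (Sym2.mem_mk_left x y))
  simp only [openGraph_adj, configOfLabels, Set.mem_setOf_eq, hxy]

/-- **The event `{B = Tᶜ}` depends only on the labels of the pairs not inside `T`** (`T ⊆ D`; `B(U)`
the set of vertices joined at level `p` to the outside of `D`). -/
private theorem dependsOn_burnt_eq {V : Type*} (G : SimpleGraph V) (p : ℝ) {D T : Set V}
    (hTD : T ⊆ D) :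
    DependsOn (fun U : Sym2 V → ℝ => U ∈ {U : Sym2 V → ℝ |
        {v : V | ∃ w : V, w ∉ D ∧ (openGraph (configOfLabels p U G)).Reachable v w} = Tᶜ})
      {e : Sym2 V | ∀ y ∈ e, y ∈ T}ᶜ := by
  intro U U' hUU'
  have hagree : ∀ e : Sym2 V, ¬ (∀ y ∈ e, y ∈ T) → U e = U' e := fun e he => hUU' e he
  simp only [Set.mem_setOf_eq, eq_iff_iff]
  exact ⟨burnt_eq_compl_transfer hTD (fun x y hx => openGraph_adj_iff_of_agree G p hagree x y hx),
    burnt_eq_compl_transfer hTD fun x y hx => (openGraph_adj_iff_of_agree G p hagree x y hx).symm⟩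

/-! ### Measurability -/

/-- For each vertex `v`, the event "`v` is joined at level `p` to a vertex outside `D`" is
measurable in the labels: a countable union over the endpoint `w ∉ D` of the preimages of the
connection events `{v ↔ w}` (`measurableSet_openConn_holds`) under the measurable thresholding map
`U ↦ η_p(U)` (`measurable_configOfLabels`). -/
private theorem measurableSet_joined_outside {V : Type*} [Countable V] (G : SimpleGraph V) (p : ℝ)
    (D : Set V) (v : V) :
    MeasurableSet {U : Sym2 V → ℝ | ∃ w : V, w ∉ D ∧
      (openGraph (configOfLabels p U G)).Reachable v w} := by
  have hset : {U : Sym2 V → ℝ | ∃ w : V, w ∉ D ∧ (openGraph (configOfLabels p U G)).Reachable v w} =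
      ⋃ w ∈ Dᶜ, (fun U : Sym2 V → ℝ => configOfLabels p U G) ⁻¹' openConn v w := by
    ext U
    simp only [openConn, Set.mem_setOf_eq, Set.mem_iUnion, Set.mem_compl_iff, Set.mem_preimage,
      exists_prop]
  rw [hset]
  exact MeasurableSet.biUnion (Set.to_countable _) fun w _ =>
    measurable_configOfLabels p G (measurableSet_openConn_holds v w)

/-- The burnt-set map `U ↦ B(U) ∈ Set V` is measurable (coordinatewise, `measurable_set_iff`). -/
private theorem measurable_burnt {V : Type*} [Countable V] (G : SimpleGraph V) (p : ℝ) (D : Set V) :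
    Measurable fun U : Sym2 V → ℝ =>
      {v : V | ∃ w : V, w ∉ D ∧ (openGraph (configOfLabels p U G)).Reachable v w} :=
  measurable_set_iff.2 fun v => measurableSet_setOf.1 (measurableSet_joined_outside G p D v)

/-- The level sets `{U | B(U) = A}` of the burnt-set map are measurable (`Set V` has measurable
singletons for countable `V`). -/
private theorem measurableSet_burnt_eq {V : Type*} [Countable V] (G : SimpleGraph V) (p : ℝ)
    (D A : Set V) :
    MeasurableSet {U : Sym2 V → ℝ |
      {v : V | ∃ w : V, w ∉ D ∧ (openGraph (configOfLabels p U G)).Reachable v w} = A} :=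
  measurableSet_setOf.2 ((measurable_burnt G p D).eq_const A)

/-- The level-`q` configuration restricted to the pairs inside `T`, `W ↦ {e ∈ η_q(W) | e ⊆ T}`, is
measurable in the labels `W`. -/
private theorem measurable_vacantIn {V : Type*} (G : SimpleGraph V) (q : ℝ) (T : Set V) :
    Measurable fun W : Sym2 V → ℝ =>
      {e : Sym2 V | e ∈ configOfLabels q W G ∧ ∀ y ∈ e, y ∈ T} :=
  measurable_set_iff.2 fun e =>
    (measurable_set_iff.1 (measurable_configOfLabels q G) e).and measurable_const

/-- `W ↦ {e ∈ η_q(W) | e ⊆ T}` depends only on the labels of the pairs inside `T`. -/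
private theorem dependsOn_vacantIn {V : Type*} (G : SimpleGraph V) (q : ℝ) (T : Set V) :
    DependsOn (fun W : Sym2 V → ℝ => {e : Sym2 V | e ∈ configOfLabels q W G ∧ ∀ y ∈ e, y ∈ T})
      {e : Sym2 V | ∀ y ∈ e, y ∈ T} := by
  intro W W' hWW'
  ext e
  simp only [Set.mem_setOf_eq, configOfLabels]
  by_cases he : ∀ y ∈ e, y ∈ T
  · rw [hWW' e he]
  · simp only [he, and_false]

/-- Hence `W ↦ {e ∈ η_q(W) | e ⊆ T}` is measurable for the cylinder σ-algebra of the pairs inside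
`T`. -/
private theorem measurable_vacantIn_cyl {V : Type*} (G : SimpleGraph V) (q : ℝ) (T : Set V) :
    Measurable[cylinderEvents (X := fun _ : Sym2 V => ℝ) {e : Sym2 V | ∀ y ∈ e, y ∈ T}]
      fun W : Sym2 V → ℝ => {e : Sym2 V | e ∈ configOfLabels q W G ∧ ∀ y ∈ e, y ∈ T} :=
  (measurable_vacantIn G q T).measurable_cylinderEvents_of_dependsOn (dependsOn_vacantIn G q T)

/-- **Disjoint sets of labels are independent**: under `labelMeasure V = ⨂_e Leb|[0,1]` the cylinder
σ-algebras of two disjoint sets of pairs are independent (the coordinates of an infinite product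
measure are independent, `iIndepFun_infinitePi`; grouping, `indep_iSup_of_disjoint`). -/
private theorem indep_cylinderEvents_labelMeasure (V : Type*) {Δ₁ Δ₂ : Set (Sym2 V)}
    (h : Disjoint Δ₁ Δ₂) :
    Indep (cylinderEvents (X := fun _ : Sym2 V => ℝ) Δ₁) (cylinderEvents (X := fun _ : Sym2 V => ℝ) Δ₂)
      (labelMeasure V) := by
  have := isProbabilityMeasure_volume_restrict_unitInterval
  have hi : iIndepFun (fun (e : Sym2 V) (U : Sym2 V → ℝ) => U e) (labelMeasure V) :=
    iIndepFun_infinitePi (P := fun _ : Sym2 V => (volume : Measure ℝ).restrict (Set.Icc (0 : ℝ) 1))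
      (X := fun _ x => x) fun _ => measurable_id
  rw [iIndepFun_iff_iIndep] at hi
  exact indep_iSup_of_disjoint (fun e => (measurable_pi_apply e).comap_le) hi h

/-! ### The finite decomposition -/

/-- Every vertex outside the box is burnt, so the burnt set is `Tᶜ` for the finite set `T ⊆ D` of
unburnt vertices of the box. -/
private theorem exists_burnt_eq_compl {V : Type*} (G : SimpleGraph V) (p : ℝ) (D : Finset V)
    (U : Sym2 V → ℝ) :
    ∃ T ∈ D.powerset, {v : V | ∃ w : V, w ∉ (D : Set V) ∧
      (openGraph (configOfLabels p U G)).Reachable v w} = ((T : Set V))ᶜ := by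
  classical
  refine ⟨D.filter fun v => ¬ ∃ w : V, w ∉ (D : Set V) ∧
      (openGraph (configOfLabels p U G)).Reachable v w,
    Finset.mem_powerset.2 (Finset.filter_subset _ _), ?_⟩
  ext v
  simp only [Set.mem_setOf_eq, Set.mem_compl_iff, Finset.coe_filter, not_and, not_not]
  constructor
  · exact fun hv _ => hv
  · intro hv
    by_cases hvD : v ∈ D
    · exact hv hvD
    · exact ⟨v, fun h' => hvD (Finset.mem_coe.1 h'), SimpleGraph.Reachable.refl _⟩

/-- On `{B = Tᶜ}` the vacant configuration off the burnt set is the level-`q` configuration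
restricted to the pairs inside `T`. -/
private theorem vacantOff_eq_vacantIn {V : Type*} {G : SimpleGraph V} {p : ℝ} (q : ℝ) {D T : Set V}
    {U : Sym2 V → ℝ}
    (h : {v : V | ∃ w : V, w ∉ D ∧ (openGraph (configOfLabels p U G)).Reachable v w} = Tᶜ)
    (W : Sym2 V → ℝ) :
    {e : Sym2 V | e ∈ configOfLabels q W G ∧ ∀ y ∈ e, ¬ ∃ w : V, w ∉ D ∧
        (openGraph (configOfLabels p U G)).Reachable y w} =
      {e : Sym2 V | e ∈ configOfLabels q W G ∧ ∀ y ∈ e, y ∈ T} := by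
  have hmem : ∀ y : V, (∃ w : V, w ∉ D ∧ (openGraph (configOfLabels p U G)).Reachable y w) ↔ y ∉ T :=
    fun y => by simpa only [Set.mem_setOf_eq, Set.mem_compl_iff] using Set.ext_iff.1 h y
  ext e
  simp only [Set.mem_setOf_eq, hmem, not_not]

/-- **Finite-volume Markov identity of the burnt set**, for any graph on a countable vertex type,
any finite box `D` and any levels `p, q`: the pair (burnt set, level-`q` vacant configuration off the
burnt set) has the same law under `μ ⊗ μ` whether the vacant configuration is read from the
environment labels or from an independent copy. -/
private theorem labelMeasure_prod_markov {V : Type*} [Countable V] (G : SimpleGraph V) (p q : ℝ)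
    (D : Finset V) {S : Set (Set V × Set (Sym2 V))} (hS : MeasurableSet S) :
    (labelMeasure V).prod (labelMeasure V)
        {π | ({v : V | ∃ w : V, w ∉ (D : Set V) ∧
                (openGraph (configOfLabels p π.1 G)).Reachable v w},
              {e : Sym2 V | e ∈ configOfLabels q π.1 G ∧ ∀ y ∈ e, ¬ ∃ w : V,
                w ∉ (D : Set V) ∧ (openGraph (configOfLabels p π.1 G)).Reachable y w}) ∈ S} =
      (labelMeasure V).prod (labelMeasure V)
        {π | ({v : V | ∃ w : V, w ∉ (D : Set V) ∧
                (openGraph (configOfLabels p π.1 G)).Reachable v w},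
              {e : Sym2 V | e ∈ configOfLabels q π.2 G ∧ ∀ y ∈ e, ¬ ∃ w : V,
                w ∉ (D : Set V) ∧ (openGraph (configOfLabels p π.1 G)).Reachable y w}) ∈ S} := by
  have := isProbabilityMeasure_labelMeasure V
  refine prod_apply_eq_of_decomp (labelMeasure V) D.powerset
    (fun U : Sym2 V → ℝ => {v : V | ∃ w : V, w ∉ (D : Set V) ∧
      (openGraph (configOfLabels p U G)).Reachable v w})
    (fun T : Finset V => ((T : Set V))ᶜ)
    (fun U W : Sym2 V → ℝ => {e : Sym2 V | e ∈ configOfLabels q W G ∧ ∀ y ∈ e, ¬ ∃ w : V,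
      w ∉ (D : Set V) ∧ (openGraph (configOfLabels p U G)).Reachable y w})
    (fun (T : Finset V) (W : Sym2 V → ℝ) =>
      {e : Sym2 V | e ∈ configOfLabels q W G ∧ ∀ y ∈ e, y ∈ (T : Set V)})
    (fun T : Finset V =>
      cylinderEvents (X := fun _ : Sym2 V => ℝ) {e : Sym2 V | ∀ y ∈ e, y ∈ (T : Set V)}ᶜ)
    (fun T : Finset V =>
      cylinderEvents (X := fun _ : Sym2 V => ℝ) {e : Sym2 V | ∀ y ∈ e, y ∈ (T : Set V)})
    (fun _ => cylinderEvents_le_pi) (fun _ => cylinderEvents_le_pi)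
    (fun T => indep_cylinderEvents_labelMeasure V disjoint_compl_left)
    (exists_burnt_eq_compl G p D) ?_ (fun T U W h => vacantOff_eq_vacantIn q h W)
    (fun T hT => ?_) (fun T => measurable_vacantIn_cyl G q (T : Set V)) hS
  · intro T₁ _ T₂ _ h
    exact Finset.coe_injective (compl_injective h)
  · exact measurableSet_cyl_of_dependsOn (measurableSet_burnt_eq G p (D : Set V) _)
      (dependsOn_burnt_eq G p (Finset.coe_subset.2 (Finset.mem_powerset.1 hT)))

/-- Registered stub `stub_boxMarkov` of crux stmt-CriticalPhenomena-7204 (line vacant-coins-fresh-spine); see the line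
skeleton `Cruxes/JumpFireBreak/Lines/vacant-coins-fresh-spine.lean` for the informal statement and sources. -/
theorem stub_boxMarkov :
    ∀ (p q : ℝ) (N : ℕ) (S : Set (Set (Fin 3 → ℤ) × Set (Sym2 (Fin 3 → ℤ)))), MeasurableSet S →
    ((labelMeasure (Fin 3 → ℤ)).prod (labelMeasure (Fin 3 → ℤ)))
        {π | ({v | ∃ w : Fin 3 → ℤ, w ∉ (box 3 N : Set (Fin 3 → ℤ)) ∧
                (openGraph (configOfLabels p π.1 (zdGraph 3))).Reachable v w},
              {e | e ∈ configOfLabels q π.1 (zdGraph 3) ∧ ∀ y ∈ e, ¬ ∃ w : Fin 3 → ℤ,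
                w ∉ (box 3 N : Set (Fin 3 → ℤ)) ∧ (openGraph (configOfLabels p π.1 (zdGraph 3))).Reachable y w})
              ∈ S} =
      ((labelMeasure (Fin 3 → ℤ)).prod (labelMeasure (Fin 3 → ℤ)))
        {π | ({v | ∃ w : Fin 3 → ℤ, w ∉ (box 3 N : Set (Fin 3 → ℤ)) ∧
                (openGraph (configOfLabels p π.1 (zdGraph 3))).Reachable v w},
              {e | e ∈ configOfLabels q π.2 (zdGraph 3) ∧ ∀ y ∈ e, ¬ ∃ w : Fin 3 → ℤ,
                w ∉ (box 3 N : Set (Fin 3 → ℤ)) ∧ (openGraph (configOfLabels p π.1 (zdGraph 3))).Reachable y w})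
              ∈ S} := by
  intro p q N S hS
  exact labelMeasure_prod_markov (zdGraph 3) p q (box 3 N) hS

end Summit.CriticalPhenomena.PercolationContinuityZ3.Theorems

end
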